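import Summits.CriticalPhenomena.Ising3DConformalLimit.Theorems.AnomalousForcesInteractionEtaPositiveBoxResponse
import Literature.Probability.LatticeModels.CriticalScalingDimension
import HarnessLib

/-!
# `EtaGainIO` from an upper critical-isotherm gain along ONE sequence of fields

Support file for crux `EtaPositive` (stmt-CriticalPhenomena-2600) of route `AnomalousForcesInteraction`
(sub-problem `Ising3DConformalLimit`). Write `G(x) = ⟨σ₀σ_x⟩⁺_{β_c(3),0}` (`criticalTwoPoint 3`, sup norm on
`ℤ³`) and `m(h) = ⟨σ₀⟩⁺_{β_c(3),h}` (`magnetizationInField 3 (criticalBeta 3) h`).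

The dead line `registered` of the crux reduced `EtaPositive` to its one open stub
`stub_isothermGain : ∃ b > 1/5, A, h₀ > 0, ∀ h ∈ (0,h₀], m(h) ≤ A h^b` ("`1/δ > 1/5` in upper-bound form",
open in print). The strategist's split (glue p169603) isolates the SIGN half of the crux,

  `EtaGainIO := ∃ κ > 0, C, ∀ N, ∃ x, N < ‖x‖ ∧ G(x) ≤ C ‖x‖^{-(1+κ)}`,

and this file proves that the SUBSEQUENCE form of the dead stub already gives it:

* `etaGainIO_of_isothermGain_io` — if `m(h) ≤ A h^b` with `b > 1/5` holds for ARBITRARILY SMALL fields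
  `h > 0` (along one sequence `h_k ↓ 0`, not on a whole interval), then `EtaGainIO` holds with
  `κ = (5b-1)/(b+1)`.

Proof: at the scale `u = h^{-(b+1)/3}`, `n = ⌈u⌉`, the landed finite-box fluctuation–response bound
`stub_boxResponse` (GHS + GKS + MMS, p145276) at `(h, R = n, x = 3n e₁)` reads
`(2n+1)³ (G(x) - m²) ≤ m/(β_c h)`; with `(2n+1)³ ≥ 8u³ = 8 h^{-(b+1)}` and `m ≤ A h^b` this is
`G(x) ≤ (A² + A/(8β_c)) h^{2b}`, and `h^{2b} = u^{-(1+κ)} ≤ 6^{1+κ} ‖x‖^{-(1+κ)}` because `‖x‖ = 3n ≤ 6u`.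
Standard axioms, no named fact; the hypothesis is of course open (it implies `¬ HasIsingExponentEta 3 0`).
-/

noncomputable section

namespace Summit.CriticalPhenomena.Ising3DConformalLimit.AnomalousForcesInteractionEtaPositive

open Finset Literature.Probability.LatticeModels

/-- **`EtaGainIO` from an upper critical-isotherm gain along ONE sequence `h_k ↓ 0`** (the subsequence form
of the dead stub `stub_isothermGain`): if `m(β_c(3), h) ≤ A h^b` with `b > 1/5` holds for arbitrarily small
fields `h > 0`, then a power gain `κ = (5b-1)/(b+1) > 0` over the infrared bound occurs at sites of
arbitrarily large norm (effective Buckingham–Gunton at one scale per field, via `stub_boxResponse`). -/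
theorem etaGainIO_of_isothermGain_io : (∃ b A : ℝ, 1 / 5 < b ∧ ∀ ε : ℝ, 0 < ε → ∃ h : ℝ, 0 < h ∧ h < ε ∧ Literature.Probability.LatticeModels.magnetizationInField 3 (Literature.Probability.LatticeModels.criticalBeta 3) h ≤ A * h ^ b) → ∃ κ C : ℝ, 0 < κ ∧ ∀ N : ℕ, ∃ x : Literature.Probability.LatticeModels.Site 3, (N : ℝ) < ‖x‖ ∧ Literature.Probability.LatticeModels.criticalTwoPoint 3 x ≤ C * (‖x‖ : ℝ) ^ (-(1 + κ)) := by
  rintro ⟨b, A, hb, hio⟩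
  -- constants of the model
  have hβ : 0 < criticalBeta 3 := criticalBeta_pos_holds (d := 3) (by norm_num)
  have hm0 : ∀ h : ℝ, 0 ≤ h → 0 ≤ magnetizationInField 3 (criticalBeta 3) h := fun h hh => by
    rw [magnetizationInField_eq_plusCorr]
    exact plusCorr_nonneg (d := 3) hβ.le hh _
  -- normalised amplitude `A' ≥ 1`
  set A' : ℝ := max A 1 with hA'def
  have hA'1 : 1 ≤ A' := le_max_right _ _
  have hA'0 : 0 < A' := one_pos.trans_le hA'1
  have hAA' : A ≤ A' := le_max_left _ _
  -- exponents: gain `κ = (5b-1)/(b+1)`, length-scale exponent `e = (b+1)/3` (`u = h^{-e}`)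
  have hb0 : 0 < b := lt_trans (by norm_num) hb
  have hb1 : 0 < b + 1 := by linarith
  set κ : ℝ := (5 * b - 1) / (b + 1) with hκdef
  have hκ0 : 0 < κ := div_pos (by linarith) hb1
  set e : ℝ := (b + 1) / 3 with hedef
  have he0 : 0 < e := by positivity
  have heκ : -e * -(1 + κ) = 2 * b := by
    rw [hedef, hκdef]; field_simp; ring
  have he3 : -e * ((3 : ℕ) : ℝ) + (b + 1) = 0 := by
    rw [hedef]; push_cast; ring
  -- the constant
  set K : ℝ := (A' ^ 2 + A' / (8 * criticalBeta 3)) * (6 : ℝ) ^ (1 + κ) with hKdef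
  refine ⟨κ, K, hκ0, fun N => ?_⟩
  -- a field `h` so small that `h < 1/2` and `u = h^{-e} > N + 1`
  set ε : ℝ := min (1 / 2) (((N : ℝ) + 1) ^ (-(1 / e))) with hεdef
  have hε0 : 0 < ε := lt_min (by norm_num) (Real.rpow_pos_of_pos (by positivity) _)
  obtain ⟨h, hh0, hhε, hM⟩ := hio ε hε0
  have hhne : h ≠ 0 := hh0.ne'
  have hh1 : h ≤ 1 := by
    have : h < 1 / 2 := lt_of_lt_of_le hhε (min_le_left _ _)
    linarith
  set u : ℝ := h ^ (-e) with hudef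
  have hu0 : 0 < u := Real.rpow_pos_of_pos hh0 _
  have huN : (N : ℝ) + 1 < u := by
    have h1 : h < ((N : ℝ) + 1) ^ (-(1 / e)) := lt_of_lt_of_le hhε (min_le_right _ _)
    have h2 : (((N : ℝ) + 1) ^ (-(1 / e))) ^ (-e) < h ^ (-e) :=
      Real.rpow_lt_rpow_of_neg hh0 h1 (by linarith)
    have h3 : (((N : ℝ) + 1) ^ (-(1 / e))) ^ (-e) = (N : ℝ) + 1 := by
      rw [← Real.rpow_mul (by positivity)]
      have : -(1 / e) * -e = 1 := by field_simp
      rw [this, Real.rpow_one]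
    rw [h3] at h2
    exact h2
  -- the scale `n = ⌈u⌉`, `u ≤ n ≤ 2u`
  set n : ℕ := ⌈u⌉₊ with hndef
  have hun : u ≤ n := Nat.le_ceil u
  have hu1 : 1 ≤ u := Real.one_le_rpow_of_pos_of_le_one_of_nonpos hh0 hh1 (by linarith)
  have hn2u : (n : ℝ) ≤ 2 * u := by
    have := Nat.ceil_lt_add_one hu0.le
    rw [← hndef] at this
    linarith
  have hnN : N < 3 * n := by
    have h1 : (N : ℝ) + 1 < n := huN.trans_le hun
    have h2 : N + 1 < n + 1 := by exact_mod_cast (show ((N + 1 : ℕ) : ℝ) < n + 1 by push_cast; linarith)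
    omega
  have hn0 : (0 : ℝ) < n := lt_of_lt_of_le hu0 hun
  -- the site `x = 3n e₁`
  set x : Site 3 := Pi.single 0 ((3 * n : ℕ) : ℤ) with hxdef
  have hxnorm : ‖x‖ = ((3 * n : ℕ) : ℝ) := by
    rw [hxdef, norm_single_axis, Int.cast_natCast, abs_of_nonneg (Nat.cast_nonneg _)]
  have hxpos : (0 : ℝ) < ‖x‖ := by rw [hxnorm]; push_cast; linarith
  refine ⟨x, ?_, ?_⟩
  · rw [hxnorm]; exact_mod_cast hnN
  · -- the box inequality at `(h, R = n, x)`
    have hbox := stub_boxResponse h hh0 n x (by rw [hxnorm]; push_cast; linarith)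
    set m : ℝ := magnetizationInField 3 (criticalBeta 3) h with hmdef
    set P : ℝ := (2 * (n : ℝ) + 1) ^ 3 with hPdef
    have hP0 : 0 < P := by positivity
    have hmnn : 0 ≤ m := hm0 h hh0.le
    have hsb0 : 0 < h ^ b := Real.rpow_pos_of_pos hh0 _
    have hmle : m ≤ A' * h ^ b := hM.trans (mul_le_mul_of_nonneg_right hAA' hsb0.le)
    have hm2 : m ^ 2 ≤ A' ^ 2 * (h ^ b) ^ 2 := by
      rw [← mul_pow]; exact pow_le_pow_left₀ hmnn hmle 2
    -- `P ≥ 8u³` and `u³ h^{b+1} = 1`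
    have hP8 : 8 * u ^ 3 ≤ P := by
      have h1 : (2 * u) ^ 3 ≤ (2 * (n : ℝ) + 1) ^ 3 := pow_le_pow_left₀ (by positivity) (by linarith) 3
      have h2 : (2 * u) ^ 3 = 8 * u ^ 3 := by ring
      rw [hPdef, ← h2]; exact h1
    have hid : u ^ 3 * h ^ (b + 1) = 1 := by
      rw [hudef, ← Real.rpow_natCast, ← Real.rpow_mul hh0.le, ← Real.rpow_add hh0, he3, Real.rpow_zero]
    have hsb1 : 0 < h ^ (b + 1) := Real.rpow_pos_of_pos hh0 _
    have hPinv : 1 / P ≤ h ^ (b + 1) / 8 := by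
      rw [div_le_div_iff₀ hP0 (by norm_num)]
      nlinarith [hP8, hsb1]
    -- `G(x) ≤ m² + (m/(β_c h)) · (1/P)`
    set T : ℝ := m / (criticalBeta 3 * h) with hTdef
    have hT0 : 0 ≤ T := by positivity
    have hG : criticalTwoPoint 3 x ≤ m ^ 2 + T * (1 / P) := by
      have h1 : P * criticalTwoPoint 3 x ≤ P * m ^ 2 + T := by
        rw [hPdef] at *; rw [mul_sub] at hbox; linarith
      have h2 : criticalTwoPoint 3 x ≤ (P * m ^ 2 + T) / P := by
        rw [le_div_iff₀ hP0]; linarith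
      have h3 : (P * m ^ 2 + T) / P = m ^ 2 + T * (1 / P) := by
        field_simp
      linarith [h2, h3.le]
    -- `T · (1/P) ≤ (A' h^b/(β_c h)) · h^{b+1}/8 = A'/(8β_c) · h^{2b}`
    have hTle : T ≤ A' * h ^ b / (criticalBeta 3 * h) := div_le_div_of_nonneg_right hmle (by positivity)
    have hTP : T * (1 / P) ≤ A' * h ^ b / (criticalBeta 3 * h) * (h ^ (b + 1) / 8) :=
      mul_le_mul hTle hPinv (by positivity) (by positivity)
    have hbb : h ^ b * h ^ (b + 1) = h * h ^ (2 * b) := by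
      rw [← Real.rpow_add hh0, show b + (b + 1) = 1 + 2 * b by ring, Real.rpow_add hh0, Real.rpow_one]
    have halg : A' * h ^ b / (criticalBeta 3 * h) * (h ^ (b + 1) / 8) = A' / (8 * criticalBeta 3) * h ^ (2 * b) := by
      rw [div_mul_div_comm, mul_assoc, hbb]
      field_simp
    -- `(h^b)² = h^{2b}`
    have hsq : (h ^ b) ^ 2 = h ^ (2 * b) := by
      rw [← Real.rpow_natCast, ← Real.rpow_mul hh0.le]; congr 1; push_cast; ring
    have hmain : criticalTwoPoint 3 x ≤ (A' ^ 2 + A' / (8 * criticalBeta 3)) * h ^ (2 * b) := by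
      calc criticalTwoPoint 3 x ≤ m ^ 2 + T * (1 / P) := hG
        _ ≤ A' ^ 2 * (h ^ b) ^ 2 + A' * h ^ b / (criticalBeta 3 * h) * (h ^ (b + 1) / 8) :=
            add_le_add hm2 hTP
        _ = (A' ^ 2 + A' / (8 * criticalBeta 3)) * h ^ (2 * b) := by rw [halg, hsq]; ring
    -- `h^{2b} = u^{-(1+κ)} ≤ (‖x‖/6)^{-(1+κ)} = 6^{1+κ} ‖x‖^{-(1+κ)}`
    have hu2b : h ^ (2 * b) = u ^ (-(1 + κ)) := by
      rw [hudef, ← Real.rpow_mul hh0.le, heκ]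
    have hxu : ‖x‖ / 6 ≤ u := by
      rw [hxnorm]; push_cast; linarith
    have hx6 : 0 < ‖x‖ / 6 := by positivity
    have hupow : u ^ (-(1 + κ)) ≤ (‖x‖ / 6) ^ (-(1 + κ)) :=
      Real.rpow_le_rpow_of_nonpos hx6 hxu (by linarith)
    have hsix : (‖x‖ / 6) ^ (-(1 + κ)) = (6 : ℝ) ^ (1 + κ) * ‖x‖ ^ (-(1 + κ)) := by
      rw [Real.div_rpow (norm_nonneg _) (by norm_num), Real.rpow_neg (by norm_num : (0 : ℝ) ≤ 6),
        div_inv_eq_mul, mul_comm]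
    have hcoef : 0 ≤ A' ^ 2 + A' / (8 * criticalBeta 3) := by positivity
    calc criticalTwoPoint 3 x ≤ (A' ^ 2 + A' / (8 * criticalBeta 3)) * h ^ (2 * b) := hmain
      _ = (A' ^ 2 + A' / (8 * criticalBeta 3)) * u ^ (-(1 + κ)) := by rw [hu2b]
      _ ≤ (A' ^ 2 + A' / (8 * criticalBeta 3)) * ((6 : ℝ) ^ (1 + κ) * ‖x‖ ^ (-(1 + κ))) :=
          mul_le_mul_of_nonneg_left (hupow.trans hsix.le) hcoef
      _ = K * ‖x‖ ^ (-(1 + κ)) := by rw [hKdef]; ring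

end Summit.CriticalPhenomena.Ising3DConformalLimit.AnomalousForcesInteractionEtaPositive
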